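import Mathlib
import Literature.MathematicalPhysics.QuantumFieldTheory.Balaban1983to89.B15TouchingCubeDomains
import Literature.MathematicalPhysics.QuantumFieldTheory.Balaban1983to89.B6Decomp247LatticeTwoSided

/-!
# `Balaban1983to89.B15LatticeCubeContours` — [Balaban1984PropagatorsII] (2.46) READ LITERALLY ON THE ℤᵈ CUBE CARRIER: the
# LATTICE CONTOUR GRAPH `latC` of the nested cube model (a bond = one bond of the lattice of ONE of the two cubes it joins,
# reading R0 of GAPS G-B6-22), its CONNECTEDNESS, and hence LEMMA 2.1 (2.60)–(2.63) WITH THE d-ONLY CONSTANT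
# c₁″ = 13c₀(½α)^{4d} for print's distance over ANY [III]-admissible sequence of domains and over the nested boxes

statement-level skeleton of published theorems with citation tags; proofs where landed; nothing here is a claim about the Yang–Mills mass gap

CITATION HEADER (lean-in-tree rule 2026-08-18).  Sources: T. Bałaban, *Propagators and renormalization transformations for
lattice gauge theories. II*, Commun. Math. Phys. **96**, 223–250 (1984) [Balaban1984PropagatorsII] (cell paper B6; PDF held
`paper:balaban1984-cmp96-propagators-rt-ii`, journal page = PDF page + 222; pp. 224, 231–234 re-read this generation from
the text layer); T. Bałaban, *Large field renormalization. I*, Commun. Math. Phys. **122**, 175–202 (1989)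
[Balaban1989LargeFieldI] (B15; p. 179 the nested `Z″_n`, p. 186 the cube model — as typed by r12 in `B15Ineq147LevelGap`);
T. Bałaban, *Convergent renormalization expansions …* Commun. Math. Phys. **119** (1988) [Balaban1988Convergent] ((2.13)
admissible sequences, as typed by r11 in `B14DomainGeom`/`B15Ineq147Admissible`).  WHAT IS REPRODUCED: lit-balaban SKELETON
rows **B6.Lem2.1**, **B6.Eq2.56**, **B6.Eq2.47**, **B6.Eq2.45** (cells; heads unchanged — the printed c₁(α) stays refuted as
typed) on the carrier of row **B15.Eq1.47** (block owner r12; nothing of B15 restated or modified).  Unit `lit-balaban-p29`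
(Phase-2 proof seat p29, gen 12), HOME `run/shared/lean/pub/lit-balaban/`; B6 owner r03, B15 owner r12, referee ref-4.
IMPORTS, NOT MODIFIED: `…B15TouchingCubeDomains` (p29 g11; through it `…B15TouchingCubeContours`: the touching-cube graph
`touchC`, `Tiles`, `separates_touchC`, `levelGap_touchC`, the admissible-sequence and nested-box carriers;
`…B15Ineq147LevelGap`/`…B15Ineq147Admissible` (r12/r11): `cube`, `corner`, `CubeSite`, `zoneC`, `LayerSepZd`, `Touching`,
`zone_le_succ_of_touching`; `…B14DomainGeom`: `cubeIdx`, `IsUnionOfCubes`, `Within`), `…B6Decomp247LatticeTwoSided` (this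
seat, this generation: `TwoSidedDrawing`, `ineq261T_of_twoSidedDrawing`, `lemma21_full_of_twoSidedDrawing`).

THE PRINTED TEXT (B6 p. 231 [PDF 9]): *"For an arbitrary contour Γ on the lattice T_η we put |Γ| = nη, where n is a number
of bonds the contour Γ consists of. … We consider a special class of contours Γ. They have the property that a part of Γ
contained in B^j(Λ_j) consists of bonds of the lattice Λ_j. Now we define d(y, y′) = inf_{Γ_{y,y′}} Σ_j (L^jη)^{−1}
|Γ_{y,y′} ∩ B^j(Λ_j)| (2.46)"*; p. 224 [PDF 2] (2.1) *"Ω_j = B^j(Ω_j^{(j)})"*, (2.4) *"T = ⋃_j B^j(Λ_j)"*; p. 234 Lemma 2.1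
(2.60)–(2.63) (verbatim in `B6.Lemma21`).

THE POINT.  With `…B6Decomp247Lattice`/`…B6Decomp247LatticeTwoSided` the tree derives Lemma 2.1 with a constant depending
on d, δ₀, α ONLY (c₁″; print: c₁(α) = 12c₀(½α)^d, refuted as typed) for every contour system carrying a (two-sided)
lattice drawing — but the only INSTANCES were the towers of `B6LevelTower`, where every interface has its coarse side in
one direction.  Off the towers the tree's Lemma 2.1 (`B15TouchingCubeDomains.lemma21_admissible`, p21's
`B6Geom246MultiLevelBox.lemma21_box`) used the touching-block reading R2 of (2.46), for which only the L-DEPENDENT constant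
`K261` is possible (GAPS G-B6-22 (iii)).  THIS FILE builds print's literal reading R0 on the general carrier and closes the
gap (B6-CLOSURE §3.7(iv), second half).  §1 `latC M₁ L Z″`: on the cube-sites of r12's ℤᵈ model (scale-n cubes of side
M₁Lⁿ tiling the layer `Z″_{n+1}∖Z″_n`) two cubes are joined iff the corner of one is the corner of the other moved by THE
SIDE OF THAT OTHER cube along a positive axis (`LatStep`): inside a layer these are the bonds of Λ_n between neighbouring
blocks; across an interface they are, at a face of outward normal −e_μ of the coarser region, the bond of the FINER lattice
from the last fine corner to the coarse corner on the face, and at a face of outward normal +e_μ the bond of the COARSER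
lattice from the coarse corner to the fine corner at the far end of that edge — exactly the two crossing types of reading R0
(G-B6-22), nothing else.  `latC ≤ touchC` (`latC_le_touchC`), so `Separates` and the walk form of (2.2) `LevelGap … (M/M₁)`
are INHERITED from the R2 file (`separates_anti`, `levelGap_anti`; `separates_latC`, `levelGap_latC`).  §2: corners are
injective on cube-sites (`site_eq_of_mem`: the layers are disjoint and the cubes partition), so the model IS a two-sided
lattice drawing (`latDrawing`: positions = corners ∈ ℤᵈ, frame = id, bscale n = M₁Lⁿ).  §3 THE WORK: `latC` IS CONNECTED
(`latC_connected`) under nested `Z″`, one separating layer `LayerSepZd Z″ M L`, the covering `Tiles`, `1 ≤ M₁ ≤ M`, `L ≥ 2`.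
Proof: lattice points one unit step apart lie in `latC`-reachable cubes (`reachable_of_adjacent_points`), hence any two
cubes are joined (coordinatewise induction as in the R2 file).  The unit step x → x + e_μ from a cube s into a different
cube t has three cases (scales differ by ≤ 1, `zone_le_succ_of_touching`): same scale — t is the next cube, one Λ_n-bond
(`adj_of_step_same`); t COARSER — s lies against the −e_μ face of t, and THE SLAB of thickness M₁Lⁿ under that face consists
of scale-n cube-SITES (`layer_of_near`: a point there is too close to t to lie in `Z″_n` by the separating layer, and a
coarser cube through it would contain the whole partition block of the slab, hence the known scale-n point —
`mem_cube_of_sameIdx`, `site_eq_of_mem`), so s is joined inside the slab (`reachable_in_box`, Λ_n-bonds) to the scale-n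
cube at the corner of t, one Λ_n-bond from t (`reachable_of_step_up`); t FINER — the Λ_{n+1}-bond from the corner of s along +e_μ (THE COARSER
BOND ACROSS THE INTERFACE) ends at the corner of a scale-n site in the slab above the +e_μ face of s, joined to t inside that
slab (`reachable_of_step_down`).  §4–§6 CONSEQUENCES: `ineq261T_latC` / `sum_exp_le_latC` ((2.61″) with c₁″ for every
geometry realised by `latC`, NO graph-theoretic hypothesis left), the named geometry `latGeo` (sites = any finite set of
cube-sites, distance = (2.46) in `latC` by construction, `realizes_latGeo`) with `ineq261T_latGeo`, `lemma21_full_latGeo`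
((2.60)–(2.63)), and the two carriers of the R2 file: `lemma21_full_latGeo_admissible` — LEMMA 2.1 WITH c₁″ OVER ANY
[III] (2.13)-ADMISSIBLE SEQUENCE (r11's `hdistD`, cube unions, Ω₀ = T, termination; numerics `M₁ ∣ M`, `L ≥ 2`,
`R·M_r ≤ M/M₁`, `2 ≤ M/M₁`) — and `lemma21_full_latGeo_nestedZ` (the nested boxes: numerics only; the inhabited instance).

WHAT IS PROVED (kernel-checked; no `sorry`; axioms ⊆ {propext, Classical.choice, Quot.sound}; new definitions with bodies:
`sideZ`, `cornerC`, `LatStep`, `latC`, `latDrawing`, `latSystem`, `latGeo`; 0 new `structure`s, 0 new `def … : Prop`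
facts).  Main declarations: `latC_le_touchC`, `separates_latC`, `levelGap_latC`, `site_eq_of_mem`, `latDrawing`,
`layer_of_near`, `reachable_in_box`, `reachable_of_adjacent_points`, `latC_connected`, `ineq261T_latC`, `lemma21_full_latGeo`,
`lemma21_full_latGeo_admissible`, `lemma21_full_latGeo_nestedZ`.  v1.1 (§7, theorems only): `dist_anti` /
`touchC_dist_le_latC_dist` (d_R2 ≤ d_R0 on the carrier) and the FAMILY forms `lemma21TwoScale_latGeo_family` /
`lemma21TwoScale_latGeo_admissible_family` (`B6Lemma21TwoScale.Lemma21TwoScale`: ONE d-only constant uniformly over any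
family of such geometries — the shape `DagBinding.b6Lemma21Param_of_twoScale` consumes).

TYPING ∕ DIVERGENCE (honest).  (a) READING R0 MADE DEFINITE: print says which lattice a bond INSIDE B^j(Λ_j) belongs to and
nothing about a bond between blocks of different scales; `LatStep` admits exactly the segments that are an edge, issuing
from the base corner in a positive direction, of the block of one end-point — i.e. a Λ_n-bond lying in the closure of
B^n(Λ_n) for n the scale of that end-point (GAPS G-B6-22: R0; every R1 bond of `B6Decomp247Lattice` is one, every R0 bond
joins touching blocks: d_R2 ≤ d_R0 ≤ d_R1).  Bonds of the coarser lattice issuing from a corner in a NEGATIVE direction into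
the finer region are NOT admitted (their segment lies in the finer region and is a chain of finer bonds there), nor diagonal
contacts.  (b) THE CARRIER is r12's [IV] cube model on ℤᵈ (the universal cover; no torus identification): scales counted
upward (n small = fine), `Z″_n` increasing = the complements of print's Ω (`B15TouchingCubeDomains` §(A)), cubes of side
M₁Lⁿ with M₁ ∣ M so that print's LⁿM-cube unions are unions of carrier cubes; zone = scale.  (c) THE WALK FORM OF (2.2):
`LevelGap latC zoneC (M/M₁)` — print's RM is realised by the collar width counted in carrier cubes; the consumer needs
`R·M_r ≤ M/M₁` AND `2 ≤ M/M₁` (the extra `2 ≤ N` of the two-sided reconstruction, `B6Decomp247LatticeTwoSided` TYPING (c)).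
(d) CONSTANT: c₁″ = 13c₀(½α)^{4d} under (2.59), the lineage's corrected two-scale constant (G-A13-1/G-A16-1), d-only — for
the first time in the tree off the towers and for print's own distance; NOT the printed 12c₀(½α)^d.  (e) SURFACE POINTS,
INDEXING, `[NeZero d]`: as in `B6Decomp247LatticeTwoSided` TYPING (b), (d).  (f) NOT COVERED: the torus T_η (wrap-around
contours), domains Ω_j that are unions of big blocks but violate (2.13)-type collars (excluded by print's (2.2) anyway),
anything analytic.  HONEST SCOPE: finite lattice geometry (which cubes a unit step can join, and that collars are made of
cubes of the next scale) feeding the bookkeeping Lemma 2.1 of a published proof as repaired in the tree; NOT the printed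
constant, NOT progress on any Clay problem.
-/

namespace Literature.MathematicalPhysics.QuantumFieldTheory.Balaban1983to89.B15LatticeCubeContours

open Literature.MathematicalPhysics.QuantumFieldTheory.Balaban1983to89
open B6Geometry B15Ineq147LevelGap B15Ineq147Admissible B14DomainGeom B15TouchingCubeContours B15TouchingCubeDomains

variable {d : ℕ} {M₁ L : ℕ} {Z : ℕ → Set (Fin d → ℤ)}

/-! ## §1 The lattice contour graph of the cube model (print's bonds, reading R0) -/

/-- The side `M₁Lⁿ` of a scale-n cube, as an integer. [cite: Balaban1989LargeFieldI, p.186] -/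
def sideZ (M₁ L n : ℕ) : ℤ := ((M₁ * L ^ n : ℕ) : ℤ)

/-- The corner (base point) of a cube-site — its lattice point y ∈ Λ_n. [cite: Balaban1984PropagatorsII, (2.45) p.231] -/
def cornerC (s : CubeSite M₁ L Z) : Fin d → ℤ := corner M₁ L s.1.1 s.1.2

/-- **ONE BOND OF THE LATTICE Λ_n FROM A SCALE-n CUBE** (p. 231 *"a part of Γ contained in B^j(Λ_j) consists of bonds of the
lattice Λ_j"*, read literally, GAPS G-B6-22 reading R0): the corner of t is the corner of s moved by the side of s along a
positive axis — t is the next scale-n cube, or (across an interface, through a face of outward normal +e_μ of the region of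
s) a cube of another scale whose corner is the end-point of that Λ_n-bond. [cite: Balaban1984PropagatorsII, (2.46) p.231] -/
def LatStep (s t : CubeSite M₁ L Z) : Prop :=
  ∃ μ : Fin d, cornerC t = cornerC s + Pi.single μ (sideZ M₁ L (zoneC s))

/-- **THE LATTICE CONTOUR GRAPH** of the ℤᵈ cube model: two distinct cube-sites are joined when one is reached from the other
by one bond of the lattice of EITHER of them (`LatStep s t ∨ LatStep t s`) — print's admissible bonds in reading R0; a
subgraph of the touching-cube graph `touchC` (reading R2). [cite: Balaban1984PropagatorsII, (2.46) p.231] -/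
def latC (M₁ L : ℕ) (Z : ℕ → Set (Fin d → ℤ)) : SimpleGraph (CubeSite M₁ L Z) :=
  SimpleGraph.fromRel LatStep

/-- Unfolding of the adjacency of `latC`. [cite: Balaban1984PropagatorsII, (2.46) p.231] -/
theorem latC_adj {s t : CubeSite M₁ L Z} : (latC M₁ L Z).Adj s t ↔ s ≠ t ∧ (LatStep s t ∨ LatStep t s) := by
  rw [latC, SimpleGraph.fromRel_adj]

/-- One unit step in one coordinate moves a lattice point by sup-distance `≤ 1`. [folklore] -/
private theorem dist_toR_update_le_one (x : Fin d → ℤ) (μ : Fin d) (v : ℤ) :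
    dist (toR (Function.update x μ v)) (toR (Function.update x μ (v + 1))) ≤ 1 := by
  refine (dist_pi_le_iff zero_le_one).mpr fun ν => ?_
  rw [Real.dist_eq]
  unfold toR
  by_cases hν : ν = μ
  · subst hν
    simp
  · simp [Function.update_of_ne hν]

/-- A lattice bond joins TOUCHING cubes: the end-point of the bond is the corner of t, the point before it lies in s.
[cite: Balaban1984PropagatorsII, (2.46) p.231] -/
theorem touching_of_latStep (hM₁ : 0 < M₁) (hL : 0 < L) {s t : CubeSite M₁ L Z} (h : LatStep s t) : Touching s t := by
  obtain ⟨μ, hμ⟩ := h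
  have hs : 0 < M₁ * L ^ s.1.1 := Nat.mul_pos hM₁ (Nat.pow_pos hL)
  have ht : 0 < M₁ * L ^ t.1.1 := Nat.mul_pos hM₁ (Nat.pow_pos hL)
  refine ⟨Function.update (cornerC t) μ (cornerC t μ - 1), ?_, cornerC t, corner_mem_cube ht _, ?_⟩
  · intro ν
    by_cases hν : ν = μ
    · subst hν
      rw [Function.update_self, hμ]
      simp only [Pi.add_apply, Pi.single_eq_same, cornerC, corner, sideZ]
      have : (1 : ℤ) ≤ ((M₁ * L ^ s.1.1 : ℕ) : ℤ) := by exact_mod_cast hs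
      change ((M₁ * L ^ zoneC s : ℕ) : ℤ) * s.1.2 ν ≤ _ ∧ _ < ((M₁ * L ^ zoneC s : ℕ) : ℤ) * (s.1.2 ν + 1)
      simp only [zoneC]
      constructor <;> nlinarith
    · rw [Function.update_of_ne hν, hμ]
      simp only [Pi.add_apply, Pi.single_eq_of_ne hν, add_zero]
      exact corner_mem_cube hs _ ν
  · refine (dist_pi_le_iff zero_le_one).mpr fun ν => ?_
    rw [Real.dist_eq]
    unfold toR
    by_cases hν : ν = μ
    · subst hν
      simp
    · simp [Function.update_of_ne hν]

/-- **Every lattice bond is a contact of cubes**: `latC ≤ touchC` (reading R0 ⊂ reading R2, GAPS G-B6-22: d_R2 ≤ d_R0).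
[cite: Balaban1984PropagatorsII, (2.46) p.231] -/
theorem latC_le_touchC (hM₁ : 0 < M₁) (hL : 0 < L) : latC M₁ L Z ≤ touchC M₁ L Z := by
  intro s t h
  obtain ⟨hne, hst | hts⟩ := latC_adj.mp h
  · exact touchC_adj.mpr ⟨hne, touching_of_latStep hM₁ hL hst⟩
  · exact touchC_adj.mpr ⟨hne, touching_symm (touching_of_latStep hM₁ hL hts)⟩

/-- `Separates` passes to subgraphs (fewer bonds). [cite: Balaban1984PropagatorsII, p.231] -/
theorem separates_anti {V : Type*} {G G' : SimpleGraph V} {zone : V → ℕ} (h : G ≤ G') (hs : Separates G' zone) :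
    Separates G zone := fun _ _ huv => hs (h huv)

/-- The walk form of (2.2) passes to subgraphs (a chain of bonds of G is one of G′, of the same length).
[cite: Balaban1984PropagatorsII, (2.2) p.224] -/
theorem levelGap_anti {V : Type*} {G G' : SimpleGraph V} {zone : V → ℕ} {N : ℕ} (h : G ≤ G')
    (hg : LevelGap G' zone N) : LevelGap G zone N := by
  intro i u x hu hx p
  have h1 := hg hu hx (p.mapLe h)
  have h2 : (p.mapLe h).length = p.length := by
    have a := (p.mapLe h).length_support
    have b := p.length_support
    rw [SimpleGraph.Walk.support_mapLe_eq_support] at a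
    omega
  omega

/-- *"The surface Σ_j separates …"* for the lattice contours of the cube model: joined cubes have equal or consecutive scales
(inherited from `separates_touchC`; nested `Z″`, one separating layer, `M ≥ 1`, `M₁ ≥ 1`, `L ≥ 2`).
[cite: Balaban1984PropagatorsII, p.231; Balaban1989LargeFieldI, p.179] -/
theorem separates_latC {M : ℕ} (hmono : Monotone Z) (hsep : LayerSepZd Z M L) (hM₁ : 0 < M₁) (hM : 1 ≤ M)
    (hL : 2 ≤ L) : Separates (latC M₁ L Z) zoneC :=
  separates_anti (latC_le_touchC hM₁ (by omega)) (separates_touchC hmono hsep hM hL)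

/-- **The walk form of (2.2)/(2.57) for the lattice contours**: `LevelGap latC zoneC (M/M₁)` (inherited from
`levelGap_touchC`: a chain of lattice bonds is a chain of contacts). [cite: Balaban1984PropagatorsII, (2.2) p.224, (2.57) p.233; Balaban1989LargeFieldI, p.179] -/
theorem levelGap_latC {M : ℕ} (hmono : Monotone Z) (hsep : LayerSepZd Z M L) (hM₁ : 0 < M₁) (hL : 2 ≤ L) :
    LevelGap (latC M₁ L Z) zoneC (M / M₁) :=
  levelGap_anti (latC_le_touchC hM₁ (by omega)) (levelGap_touchC hmono hsep hM₁ hL)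

/-! ## §2 The cube model is a two-sided lattice drawing (positions = corners) -/

/-- Two cube-sites whose cubes share a lattice point are equal (the layers `Z″_{n+1}∖Z″_n` are disjoint for nested `Z″`, and
the scale-n cubes partition ℤᵈ). [cite: Balaban1984PropagatorsII, (2.4) p.224; Balaban1989LargeFieldI, p.179] -/
theorem site_eq_of_mem (hmono : Monotone Z) (hM₁ : 0 < M₁) (hL : 0 < L) {s t : CubeSite M₁ L Z} {x : Fin d → ℤ}
    (hs : x ∈ cube M₁ L s.1.1 s.1.2) (ht : x ∈ cube M₁ L t.1.1 t.1.2) : s = t := by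
  have hls := s.2 hs
  have hlt := t.2 ht
  have hlev : s.1.1 = t.1.1 := by
    by_contra hne
    rcases Nat.lt_or_gt_of_ne hne with h | h
    · exact hlt.2 (hmono (show s.1.1 + 1 ≤ t.1.1 by omega) hls.1)
    · exact hls.2 (hmono (show t.1.1 + 1 ≤ s.1.1 by omega) hlt.1)
  have hsz : 0 < M₁ * L ^ s.1.1 := Nat.mul_pos hM₁ (Nat.pow_pos hL)
  have h1 : cubeIdx (M₁ * L ^ s.1.1) x = s.1.2 := (mem_cube_iff_cubeIdx hsz).mp hs
  have h2 : cubeIdx (M₁ * L ^ s.1.1) x = t.1.2 := by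
    rw [hlev]; exact (mem_cube_iff_cubeIdx (hlev ▸ hsz)).mp ht
  exact Subtype.ext (Prod.ext hlev (h1.symm.trans h2))

/-- The corner determines the cube-site. [cite: Balaban1984PropagatorsII, (2.45) p.231] -/
theorem cornerC_injective (hmono : Monotone Z) (hM₁ : 0 < M₁) (hL : 0 < L) :
    Function.Injective (cornerC (M₁ := M₁) (L := L) (Z := Z)) := by
  intro s t h
  have hs : 0 < M₁ * L ^ s.1.1 := Nat.mul_pos hM₁ (Nat.pow_pos hL)
  have ht : 0 < M₁ * L ^ t.1.1 := Nat.mul_pos hM₁ (Nat.pow_pos hL)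
  have h1 : cornerC s ∈ cube M₁ L s.1.1 s.1.2 := corner_mem_cube hs _
  have h2 : cornerC s ∈ cube M₁ L t.1.1 t.1.2 := by rw [h]; exact corner_mem_cube ht _
  exact site_eq_of_mem hmono hM₁ hL h1 h2

/-- **THE CUBE MODEL WITH ITS LATTICE CONTOURS IS A TWO-SIDED LATTICE DRAWING** (`B6Decomp247LatticeTwoSided`): positions =
corners in ℤᵈ, frame = identity, the length of a Λ_q-bond = `M₁L^q`, every bond an axis move by the side of ONE of its two
cubes, corners injective. [cite: Balaban1984PropagatorsII, (2.46) p.231] -/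
def latDrawing (hmono : Monotone Z) (hM₁ : 0 < M₁) (hL : 0 < L) :
    B6Decomp247LatticeTwoSided.TwoSidedDrawing (latC M₁ L Z) zoneC d (Fin d → ℤ) where
  pos := cornerC
  frame := AddMonoidHom.id _
  bscale := sideZ M₁ L
  step := by
    intro u v h
    obtain ⟨-, hst | hts⟩ := latC_adj.mp h
    · obtain ⟨μ, hμ⟩ := hst
      refine ⟨μ, 1, zoneC u, Or.inl rfl, Or.inl rfl, ?_⟩
      rw [hμ, one_mul, AddMonoidHom.id_apply, add_sub_cancel_left]
    · obtain ⟨μ, hμ⟩ := hts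
      refine ⟨μ, -1, zoneC v, Or.inr rfl, Or.inr rfl, ?_⟩
      rw [hμ, AddMonoidHom.id_apply, neg_one_mul, Pi.single_neg, sub_add_cancel_left]
  inj := cornerC_injective hmono hM₁ hL

/-- The positions of the drawing are the corners. [cite: Balaban1984PropagatorsII, (2.45) p.231] -/
@[simp] theorem latDrawing_pos (hmono : Monotone Z) (hM₁ : 0 < M₁) (hL : 0 < L) :
    (latDrawing hmono hM₁ hL).pos = cornerC (M₁ := M₁) (L := L) (Z := Z) := rfl

/-! ## §3 The lattice contours CONNECT the cube model ((2.46) is a genuine minimum in reading R0) -/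

section Connected

/-- Membership in a cube, unfolded. [folklore] -/
private theorem mem_cube {n : ℕ} {c x : Fin d → ℤ} :
    x ∈ cube M₁ L n c ↔ ∀ μ, ((M₁ * L ^ n : ℕ) : ℤ) * c μ ≤ x μ ∧ x μ < ((M₁ * L ^ n : ℕ) : ℤ) * (c μ + 1) := Iff.rfl

/-- The corner of the cube-site `(n, c)` is `M₁Lⁿ·c`. [folklore] -/
private theorem cornerC_apply (s : CubeSite M₁ L Z) (ν : Fin d) :
    cornerC s ν = ((M₁ * L ^ s.1.1 : ℕ) : ℤ) * s.1.2 ν := rfl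

/-- From `S·a ≤ x < S·(b+1)` (S > 0): `a ≤ b`. [folklore] -/
private theorem idx_le_of_bounds {S a b x : ℤ} (hS : 0 < S) (h1 : S * a ≤ x) (h2 : x < S * (b + 1)) : a ≤ b := by
  have h : S * a < S * (b + 1) := lt_of_le_of_lt h1 h2
  have := lt_of_mul_lt_mul_left h hS.le
  omega

/-- **Same-scale neighbours are joined**: two scale-n cube-sites whose indices differ by `e_μ` are adjacent in `latC`
(one bond of Λ_n). [cite: Balaban1984PropagatorsII, (2.46) p.231] -/
theorem latC_adj_of_idx_succ {u v : CubeSite M₁ L Z} {μ : Fin d} (hn : v.1.1 = u.1.1)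
    (hc : v.1.2 = Function.update u.1.2 μ (u.1.2 μ + 1)) : (latC M₁ L Z).Adj u v := by
  refine latC_adj.mpr ⟨?_, Or.inl ⟨μ, ?_⟩⟩
  · intro h
    have := congrArg (fun w : CubeSite M₁ L Z => w.1.2 μ) h
    simp only [hc, Function.update_self] at this
    omega
  · funext ν
    simp only [Pi.add_apply, cornerC_apply, hn, hc, sideZ, zoneC]
    by_cases hν : ν = μ
    · subst hν
      rw [Function.update_self, Pi.single_eq_same]
      ring
    · rw [Function.update_of_ne hν, Pi.single_eq_of_ne hν, add_zero]

/-- A union of `s·t`-cubes is a union of `s`-cubes (nested partitions; as in `B15TouchingCubeContours`). [folklore] -/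
private theorem isUnionOfCubes_of_mul {s t : ℕ} {Λ : Set (Fin d → ℤ)} (h : IsUnionOfCubes (s * t) Λ) :
    IsUnionOfCubes s Λ := by
  intro x y hxy
  apply h
  funext i
  have hi := congrFun hxy i
  unfold cubeIdx at hi ⊢
  push_cast
  rw [← Int.ediv_ediv_of_nonneg (Int.natCast_nonneg s), ← Int.ediv_ediv_of_nonneg (Int.natCast_nonneg s), hi]

/-- A cube is a union of the partition cubes of any finer scale: a scale-m cube containing z contains every y with the
same scale-n cube index, n ≤ m. [folklore] -/
private theorem mem_cube_of_sameIdx {n m : ℕ} (hmn : n ≤ m) (hM₁ : 0 < M₁) (hL : 0 < L) {c z y : Fin d → ℤ}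
    (hz : z ∈ cube M₁ L m c) (hzy : cubeIdx (M₁ * L ^ n) z = cubeIdx (M₁ * L ^ n) y) : y ∈ cube M₁ L m c := by
  have hSm : 0 < M₁ * L ^ m := Nat.mul_pos hM₁ (Nat.pow_pos hL)
  have hU : IsUnionOfCubes (M₁ * L ^ m) (cube M₁ L m c) := fun a b hab => by
    rw [mem_cube_iff_cubeIdx hSm, mem_cube_iff_cubeIdx hSm, hab]
  have e : M₁ * L ^ m = M₁ * L ^ n * L ^ (m - n) := by
    rw [mul_assoc, ← pow_add, Nat.add_sub_cancel' hmn]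
  rw [e] at hU
  exact ((isUnionOfCubes_of_mul hU) z y hzy).mp hz

/-- **THE SLAB LEMMA** (the collar of a coarse cube is made of cubes of the next finer scale): let t be a cube-site of scale
n + 1 and W a set of lattice points inside ONE scale-(n+1) partition cube, every point of which is within sup-distance
`M₁Lⁿ` of the cube of t; if ONE point of W lies in a scale-n cube-site, then EVERY point of W lies in the layer
`Z″_{n+1}∖Z″_n` (nested `Z″`, one separating layer of width `M·L^{n+1} > M₁Lⁿ`, the covering, `M₁ ≤ M`, `L ≥ 2`).
[cite: Balaban1984PropagatorsII, (2.2)–(2.4) p.224; Balaban1989LargeFieldI, p.179] -/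
theorem layer_of_near {M : ℕ} (hmono : Monotone Z) (hsep : LayerSepZd Z M L) (ht : Tiles M₁ L Z) (hM₁ : 0 < M₁)
    (hM : M₁ ≤ M) (hL : 2 ≤ L) {n : ℕ} (t : CubeSite M₁ L Z) (htn : t.1.1 = n + 1) (c₀ : Fin d → ℤ)
    {W : Set (Fin d → ℤ)} (hWB : W ⊆ cube M₁ L (n + 1) c₀)
    (hnear : ∀ z ∈ W, ∃ b ∈ cube M₁ L t.1.1 t.1.2, dist (toR z) (toR b) ≤ ((M₁ * L ^ n : ℕ) : ℝ))
    {s : CubeSite M₁ L Z} (hsn : s.1.1 = n) {x : Fin d → ℤ} (hxs : x ∈ cube M₁ L s.1.1 s.1.2) (hxW : x ∈ W) :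
    ∀ z ∈ W, z ∈ Z (n + 1) \ Z n := by
  intro z hzW
  have hL0 : 0 < L := by omega
  have hSn1 : 0 < M₁ * L ^ (n + 1) := Nat.mul_pos hM₁ (Nat.pow_pos hL0)
  -- (i) z ∉ Z″_n: it is too close to the cube of t, which lies outside Z″_{n+1}
  have hzn : z ∉ Z n := by
    intro hz
    obtain ⟨b, hb, hdb⟩ := hnear z hzW
    have hb' : b ∉ Z (n + 1) := by
      have := (t.2 hb).2
      rwa [htn] at this
    have hfar := hsep hz hb'
    have hlt : ((M₁ * L ^ n : ℕ) : ℝ) < (M : ℝ) * (L : ℝ) ^ (n + 1) := by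
      have h1 : (M₁ : ℝ) ≤ M := by exact_mod_cast hM
      have h2 : (2 : ℝ) ≤ L := by exact_mod_cast hL
      have h3 : (0 : ℝ) < (L : ℝ) ^ n := by positivity
      have h4 : (0 : ℝ) < M₁ := by exact_mod_cast hM₁
      have h5 : (M₁ : ℝ) * (L : ℝ) ^ n ≤ M * (L : ℝ) ^ n := mul_le_mul_of_nonneg_right h1 h3.le
      have hM0 : (0 : ℝ) < M * (L : ℝ) ^ n := lt_of_lt_of_le (mul_pos h4 h3) h5
      have h6 : (M : ℝ) * (L : ℝ) ^ n * 1 < M * (L : ℝ) ^ n * L := mul_lt_mul_of_pos_left (by linarith) hM0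
      push_cast
      rw [pow_succ, ← mul_assoc]
      linarith
    linarith
  -- (ii) the cube-site of z has scale n
  obtain ⟨u, hu⟩ := ht z
  have hum : u.1.1 = n := by
    have hzl := u.2 hu
    rcases Nat.lt_trichotomy u.1.1 n with hlt | heq | hgt
    · exact absurd (hmono (show u.1.1 + 1 ≤ n by omega) hzl.1) hzn
    · exact heq
    · -- a coarser cube through z would contain the whole partition cube of W, hence x
      exfalso
      have hzB : z ∈ cube M₁ L (n + 1) c₀ := hWB hzW
      have hxB : x ∈ cube M₁ L (n + 1) c₀ := hWB hxW
      have hidx : cubeIdx (M₁ * L ^ (n + 1)) z = cubeIdx (M₁ * L ^ (n + 1)) x := by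
        rw [(mem_cube_iff_cubeIdx hSn1).mp hzB, (mem_cube_iff_cubeIdx hSn1).mp hxB]
      have hxu : x ∈ cube M₁ L u.1.1 u.1.2 := mem_cube_of_sameIdx (by omega) hM₁ hL0 hu hidx
      have := site_eq_of_mem hmono hM₁ hL0 hxu hxs
      rw [this] at hgt
      omega
  have := u.2 hu
  rwa [hum] at this

/-- **A box of scale-n partition cubes all of which are cube-sites is connected by Λ_n-bonds** (coordinate by coordinate).
[cite: Balaban1984PropagatorsII, (2.46) p.231] -/
theorem reachable_in_box (n : ℕ) (lo hi : Fin d → ℤ)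
    (hbox : ∀ c : Fin d → ℤ, (∀ ν, lo ν ≤ c ν ∧ c ν ≤ hi ν) → cube M₁ L n c ⊆ Z (n + 1) \ Z n)
    (u v : CubeSite M₁ L Z) (hun : u.1.1 = n) (hvn : v.1.1 = n)
    (hu : ∀ ν, lo ν ≤ u.1.2 ν ∧ u.1.2 ν ≤ hi ν) (hv : ∀ ν, lo ν ≤ v.1.2 ν ∧ v.1.2 ν ≤ hi ν) :
    (latC M₁ L Z).Reachable u v := by
  classical
  -- the cube-site of an index of the box (junk `u` outside)
  let σ : (Fin d → ℤ) → CubeSite M₁ L Z := fun c =>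
    if hc : ∀ ν, lo ν ≤ c ν ∧ c ν ≤ hi ν then ⟨(n, c), hbox c hc⟩ else u
  have hσ : ∀ c, (∀ ν, lo ν ≤ c ν ∧ c ν ≤ hi ν) → (σ c).1 = (n, c) := by
    intro c hc
    simp only [σ, dif_pos hc]
  -- one unit step up in coordinate μ inside the box
  have hstep : ∀ (c : Fin d → ℤ) (μ : Fin d), (∀ ν, lo ν ≤ c ν ∧ c ν ≤ hi ν) → c μ + 1 ≤ hi μ →
      (latC M₁ L Z).Reachable (σ c) (σ (Function.update c μ (c μ + 1))) := by
    intro c μ hc hμ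
    have hc' : ∀ ν, lo ν ≤ Function.update c μ (c μ + 1) ν ∧ Function.update c μ (c μ + 1) ν ≤ hi ν := by
      intro ν
      by_cases hν : ν = μ
      · subst hν
        rw [Function.update_self]
        exact ⟨by linarith [(hc ν).1], hμ⟩
      · rw [Function.update_of_ne hν]
        exact hc ν
    have h1 := hσ c hc
    have h2 := hσ _ hc'
    refine SimpleGraph.Adj.reachable (latC_adj_of_idx_succ (μ := μ) ?_ ?_)
    · rw [show (σ (Function.update c μ (c μ + 1))).1.1 = n from congrArg Prod.fst h2,
        show (σ c).1.1 = n from congrArg Prod.fst h1]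
    · rw [show (σ (Function.update c μ (c μ + 1))).1.2 = _ from congrArg Prod.snd h2,
        show (σ c).1.2 = c from congrArg Prod.snd h1]
  -- m unit steps up
  have hline : ∀ (m : ℕ) (c : Fin d → ℤ) (μ : Fin d), (∀ ν, lo ν ≤ c ν ∧ c ν ≤ hi ν) → c μ + m ≤ hi μ →
      (latC M₁ L Z).Reachable (σ c) (σ (Function.update c μ (c μ + m))) := by
    intro m
    induction m with
    | zero => intro c μ _ _; simp
    | succ m ih =>
      intro c μ hc hm
      have h1 := ih c μ hc (by push_cast at hm ⊢; linarith)
      have hc' : ∀ ν, lo ν ≤ Function.update c μ (c μ + m) ν ∧ Function.update c μ (c μ + m) ν ≤ hi ν := by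
        intro ν
        by_cases hν : ν = μ
        · subst hν
          rw [Function.update_self]
          constructor
          · linarith [(hc ν).1]
          · push_cast at hm; linarith
        · rw [Function.update_of_ne hν]
          exact hc ν
      have h2 := hstep (Function.update c μ (c μ + m)) μ hc' (by rw [Function.update_self]; push_cast at hm ⊢; linarith)
      rw [Function.update_self, Function.update_idem] at h2
      have e : c μ + (m : ℤ) + 1 = c μ + ((m + 1 : ℕ) : ℤ) := by push_cast; ring
      rw [e] at h2
      exact h1.trans h2
  -- changing one coordinate inside the box
  have hcoord : ∀ (c : Fin d → ℤ) (μ : Fin d) (w : ℤ), (∀ ν, lo ν ≤ c ν ∧ c ν ≤ hi ν) → lo μ ≤ w → w ≤ hi μ →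
      (latC M₁ L Z).Reachable (σ c) (σ (Function.update c μ w)) := by
    intro c μ w hc hlo hhi
    rcases le_total (c μ) w with h | h
    · obtain ⟨m, hm⟩ := Int.le.dest h
      have := hline m c μ hc (by rw [hm]; exact hhi)
      rwa [hm] at this
    · obtain ⟨m, hm⟩ := Int.le.dest h
      have hc' : ∀ ν, lo ν ≤ Function.update c μ w ν ∧ Function.update c μ w ν ≤ hi ν := by
        intro ν
        by_cases hν : ν = μ
        · subst hν
          rw [Function.update_self]
          exact ⟨hlo, hhi⟩
        · rw [Function.update_of_ne hν]
          exact hc ν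
      have := hline m (Function.update c μ w) μ hc' (by rw [Function.update_self, hm]; exact (hc μ).2)
      rw [Function.update_self, Function.update_idem, hm, Function.update_eq_self] at this
      exact this.symm
  -- all coordinates, by induction on a finite set of coordinates allowed to differ
  have hall : ∀ (T : Finset (Fin d)) (c c' : Fin d → ℤ), (∀ ν, lo ν ≤ c ν ∧ c ν ≤ hi ν) →
      (∀ ν, lo ν ≤ c' ν ∧ c' ν ≤ hi ν) → (∀ ν, ν ∉ T → c ν = c' ν) →
      (latC M₁ L Z).Reachable (σ c) (σ c') := by
    intro T
    induction T using Finset.induction_on with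
    | empty =>
      intro c c' _ _ h
      rw [show c = c' from funext fun ν => h ν (Finset.notMem_empty ν)]
    | @insert μ T _ ih =>
      intro c c' hc hc' h
      refine (hcoord c μ (c' μ) hc (hc' μ).1 (hc' μ).2).trans (ih _ c' ?_ hc' fun ν hν => ?_)
      · intro ν
        by_cases hν : ν = μ
        · subst hν
          rw [Function.update_self]
          exact hc' ν
        · rw [Function.update_of_ne hν]
          exact hc ν
      · by_cases hνμ : ν = μ
        · subst hνμ
          simp
        · rw [Function.update_of_ne hνμ]
          exact h ν (by simp [hνμ, hν])
  have hσu : σ u.1.2 = u := by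
    apply Subtype.ext
    rw [hσ u.1.2 hu]
    exact Prod.ext hun.symm rfl
  have hσv : σ v.1.2 = v := by
    apply Subtype.ext
    rw [hσ v.1.2 hv]
    exact Prod.ext hvn.symm rfl
  have := hall Finset.univ u.1.2 v.1.2 hu hv (fun ν hν => absurd (Finset.mem_univ ν) hν)
  rwa [hσu, hσv] at this

/-- Face equations of two DIFFERENT cube-sites s ∋ x and t ∋ x + e_μ: the bond x → x + e_μ crosses the common face plane
`x_μ + 1 = M₁Lⁿ(c_μ + 1) = M₁L^{n′}c′_μ`. [folklore] -/
private theorem face_eqs (hmono : Monotone Z) (hM₁ : 0 < M₁) (hL : 0 < L) {s t : CubeSite M₁ L Z} (hst : s ≠ t)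
    {x : Fin d → ℤ} {μ : Fin d} (hx : x ∈ cube M₁ L s.1.1 s.1.2)
    (hy : Function.update x μ (x μ + 1) ∈ cube M₁ L t.1.1 t.1.2) :
    x μ + 1 = ((M₁ * L ^ s.1.1 : ℕ) : ℤ) * (s.1.2 μ + 1) ∧ x μ + 1 = ((M₁ * L ^ t.1.1 : ℕ) : ℤ) * t.1.2 μ := by
  have hx' := (mem_cube (M₁ := M₁)).mp hx
  have hy' := (mem_cube (M₁ := M₁)).mp hy
  constructor
  · by_contra hne
    apply hst
    refine site_eq_of_mem hmono hM₁ hL (x := Function.update x μ (x μ + 1)) ?_ hy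
    rw [mem_cube]
    intro ν
    by_cases hν : ν = μ
    · subst hν
      rw [Function.update_self]
      have := hx' ν
      constructor <;> omega
    · rw [Function.update_of_ne hν]
      exact hx' ν
  · by_contra hne
    apply hst
    refine site_eq_of_mem hmono hM₁ hL hx (x := x) ?_
    rw [mem_cube]
    intro ν
    have h := hy' ν
    by_cases hν : ν = μ
    · subst hν
      rw [Function.update_self] at h
      constructor <;> omega
    · rw [Function.update_of_ne hν] at h
      exact h

/-- Same scale: the cube of x + e_μ is the next cube, one Λ_n-bond away. [cite: Balaban1984PropagatorsII, (2.46) p.231] -/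
private theorem adj_of_step_same (hmono : Monotone Z) (hM₁ : 0 < M₁) (hL : 0 < L) {s t : CubeSite M₁ L Z} (hst : s ≠ t)
    (hn : t.1.1 = s.1.1) {x : Fin d → ℤ} {μ : Fin d} (hx : x ∈ cube M₁ L s.1.1 s.1.2)
    (hy : Function.update x μ (x μ + 1) ∈ cube M₁ L t.1.1 t.1.2) : (latC M₁ L Z).Adj s t := by
  obtain ⟨hF1, hF2⟩ := face_eqs hmono hM₁ hL hst hx hy
  have hx' := (mem_cube (M₁ := M₁)).mp hx
  have hy' := (mem_cube (M₁ := M₁)).mp hy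
  rw [hn] at hF2 hy'
  have hS : (0 : ℤ) < ((M₁ * L ^ s.1.1 : ℕ) : ℤ) := by exact_mod_cast Nat.mul_pos hM₁ (Nat.pow_pos hL)
  refine latC_adj_of_idx_succ hn (μ := μ) (funext fun ν => ?_)
  by_cases hν : ν = μ
  · subst hν
    rw [Function.update_self]
    exact mul_left_cancel₀ hS.ne' (hF2.symm.trans hF1)
  · rw [Function.update_of_ne hν]
    have h1 := hx' ν
    have h2 := hy' ν
    rw [Function.update_of_ne hν] at h2
    have a := idx_le_of_bounds hS h1.1 h2.2
    have b := idx_le_of_bounds hS h2.1 h1.2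
    omega

/-- The sup-distance from z to the point of z with μ-coordinate replaced by F is |z_μ − F|. [folklore] -/
private theorem dist_update_le {z : Fin d → ℤ} {μ : Fin d} {F : ℤ} {R : ℝ} (hR : 0 ≤ R)
    (h : |((z μ : ℤ) : ℝ) - (F : ℝ)| ≤ R) : dist (toR z) (toR (Function.update z μ F)) ≤ R := by
  refine (dist_pi_le_iff hR).mpr fun ν => ?_
  rw [Real.dist_eq]
  unfold toR
  by_cases hν : ν = μ
  · subst hν
    rwa [Function.update_self]
  · rw [Function.update_of_ne hν, sub_self, abs_zero]
    exact hR

set_option maxHeartbeats 400000 in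
/-- **Into a coarser cube** (x in a scale-n cube-site s, x + e_μ in a scale-(n+1) cube-site t: s lies against the face of
outward normal −e_μ of t): s is joined by Λ_n-bonds along that face (all cubes there are scale-n sites, `layer_of_near`)
to the scale-n cube at the corner of t, which is one Λ_n-bond away from t. [cite: Balaban1984PropagatorsII, (2.46) p.231] -/
private theorem reachable_of_step_up {M : ℕ} (hmono : Monotone Z) (hsep : LayerSepZd Z M L) (ht : Tiles M₁ L Z)
    (hM₁ : 0 < M₁) (hM : M₁ ≤ M) (hL : 2 ≤ L) {n : ℕ} {s t : CubeSite M₁ L Z} (hsn : s.1.1 = n)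
    (htn : t.1.1 = n + 1) {x : Fin d → ℤ} {μ : Fin d} (hx : x ∈ cube M₁ L s.1.1 s.1.2)
    (hy : Function.update x μ (x μ + 1) ∈ cube M₁ L t.1.1 t.1.2) : (latC M₁ L Z).Reachable s t := by
  classical
  have hL0 : 0 < L := by omega
  have hst : s ≠ t := fun h => by rw [h, htn] at hsn; omega
  obtain ⟨hF1, hF2⟩ := face_eqs hmono hM₁ hL0 hst hx hy
  have hx' := (mem_cube (M₁ := M₁)).mp hx
  have hy' := (mem_cube (M₁ := M₁)).mp hy
  rw [hsn] at hF1 hx'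
  rw [htn] at hF2 hy'
  set S : ℤ := ((M₁ * L ^ n : ℕ) : ℤ) with hSdef
  set S' : ℤ := ((M₁ * L ^ (n + 1) : ℕ) : ℤ) with hS'def
  set c := s.1.2 with hcdef
  set c' := t.1.2 with hc'def
  set F := x μ + 1 with hFdef
  have hSpos : 0 < M₁ * L ^ n := Nat.mul_pos hM₁ (Nat.pow_pos hL0)
  have hS0 : (0 : ℤ) < S := by rw [hSdef]; exact_mod_cast hSpos
  have hS1 : (1 : ℤ) ≤ S := hS0
  have hSS : S' = S * (L : ℤ) := by rw [hS'def, hSdef]; push_cast; ring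
  have hL1 : (1 : ℤ) ≤ (L : ℤ) := by exact_mod_cast hL0
  have hSle : S ≤ S' := by rw [hSS]; nlinarith
  -- the slab of thickness S under the face x_μ = F of t
  let W : Set (Fin d → ℤ) :=
    {z | F - S ≤ z μ ∧ z μ < F ∧ ∀ ν, ν ≠ μ → S' * c' ν ≤ z ν ∧ z ν < S' * (c' ν + 1)}
  have hWB : W ⊆ cube M₁ L (n + 1) (Function.update c' μ (c' μ - 1)) := by
    intro z hz
    obtain ⟨hz1, hz2, hz3⟩ := hz
    rw [mem_cube]
    intro ν
    by_cases hν : ν = μ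
    · subst hν
      rw [Function.update_self, sub_add_cancel, ← hS'def]
      constructor <;> nlinarith
    · rw [Function.update_of_ne hν, ← hS'def]
      exact hz3 ν hν
  have hnear : ∀ z ∈ W, ∃ b ∈ cube M₁ L t.1.1 t.1.2, dist (toR z) (toR b) ≤ ((M₁ * L ^ n : ℕ) : ℝ) := by
    intro z hz
    obtain ⟨hz1, hz2, hz3⟩ := hz
    refine ⟨Function.update z μ F, ?_, ?_⟩
    · rw [htn, mem_cube]
      intro ν
      by_cases hν : ν = μ
      · subst hν
        rw [Function.update_self, ← hS'def]
        constructor <;> nlinarith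
      · rw [Function.update_of_ne hν, ← hS'def]
        exact hz3 ν hν
    · apply dist_update_le (by positivity)
      rw [abs_le]
      have e : (((M₁ * L ^ n : ℕ) : ℝ)) = ((S : ℤ) : ℝ) := by rw [hSdef]; push_cast; ring
      rw [e]
      constructor
      · have : F - S ≤ z μ := hz1
        have : ((F : ℤ) : ℝ) - ((S : ℤ) : ℝ) ≤ ((z μ : ℤ) : ℝ) := by exact_mod_cast this
        linarith
      · have : ((z μ : ℤ) : ℝ) < ((F : ℤ) : ℝ) := by exact_mod_cast hz2
        have : (0 : ℝ) ≤ ((S : ℤ) : ℝ) := by exact_mod_cast hS0.le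
        linarith
  have hxW : x ∈ W := by
    refine ⟨by omega, by omega, fun ν hν => ?_⟩
    have h := hy' ν
    rwa [Function.update_of_ne hν] at h
  have hlayer := layer_of_near hmono hsep ht hM₁ hM hL t htn _ hWB hnear (s := s) hsn hx hxW
  -- the box of scale-n cubes under that face
  let lo : Fin d → ℤ := Function.update (fun ν => (L : ℤ) * c' ν) μ (c μ)
  let hi : Fin d → ℤ := Function.update (fun ν => (L : ℤ) * c' ν + L - 1) μ (c μ)
  have hbox : ∀ e : Fin d → ℤ, (∀ ν, lo ν ≤ e ν ∧ e ν ≤ hi ν) → cube M₁ L n e ⊆ Z (n + 1) \ Z n := by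
    intro e he z hz
    apply hlayer z
    rw [mem_cube, ← hSdef] at hz
    have heμ : e μ = c μ := by
      have h := he μ
      simp only [lo, hi, Function.update_self] at h
      omega
    refine ⟨?_, ?_, fun ν hν => ?_⟩
    · have := (hz μ).1; rw [heμ] at this; nlinarith
    · have := (hz μ).2; rw [heμ] at this; nlinarith
    · have h := he ν
      simp only [lo, hi, Function.update_of_ne hν] at h
      have h1 := (hz ν).1
      have h2 := (hz ν).2
      rw [hSS]
      constructor <;> nlinarith
  have hsbox : ∀ ν, lo ν ≤ c ν ∧ c ν ≤ hi ν := by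
    intro ν
    by_cases hν : ν = μ
    · subst hν
      simp only [lo, hi, Function.update_self]
      omega
    · simp only [lo, hi, Function.update_of_ne hν]
      have h1 := hx' ν
      have h2 := hy' ν
      rw [Function.update_of_ne hν, hSS] at h2
      have ea : S * ((L : ℤ) * c' ν) = S * (L : ℤ) * c' ν := by ring
      have eb : S * ((L : ℤ) * c' ν + L - 1 + 1) = S * (L : ℤ) * (c' ν + 1) := by ring
      have a : (L : ℤ) * c' ν ≤ c ν := idx_le_of_bounds hS0 (by rw [ea]; exact h2.1) h1.2
      have b : c ν ≤ (L : ℤ) * c' ν + L - 1 := idx_le_of_bounds hS0 h1.1 (by rw [eb]; exact h2.2)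
      exact ⟨a, b⟩
  -- the scale-n cube at the corner of t
  let e₀ : Fin d → ℤ := Function.update (fun ν => (L : ℤ) * c' ν) μ (c μ)
  have he₀ : ∀ ν, lo ν ≤ e₀ ν ∧ e₀ ν ≤ hi ν := by
    intro ν
    by_cases hν : ν = μ
    · subst hν
      simp only [lo, hi, e₀, Function.update_self]
      omega
    · simp only [lo, hi, e₀, Function.update_of_ne hν]
      constructor <;> nlinarith
  let k₀ : CubeSite M₁ L Z := ⟨(n, e₀), hbox e₀ he₀⟩
  have h1 : (latC M₁ L Z).Reachable s k₀ := reachable_in_box n lo hi hbox s k₀ hsn rfl hsbox he₀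
  have h2 : (latC M₁ L Z).Adj k₀ t := by
    refine latC_adj.mpr ⟨fun h => ?_, Or.inl ⟨μ, funext fun ν => ?_⟩⟩
    · have h' : k₀.1.1 = t.1.1 := congrArg (fun w : CubeSite M₁ L Z => w.1.1) h
      change n = t.1.1 at h'
      omega
    · rw [Pi.add_apply, cornerC_apply, cornerC_apply, htn]
      change S' * c' ν = S * e₀ ν + (Pi.single μ S : Fin d → ℤ) ν
      by_cases hν : ν = μ
      · subst hν
        simp only [e₀, Function.update_self, Pi.single_eq_same]
        linear_combination hF1 - hF2
      · simp only [e₀, Function.update_of_ne hν, Pi.single_eq_of_ne hν, add_zero]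
        rw [hSS]
        ring
  exact h1.trans h2.reachable

/-- **Into a finer cube** (x in a scale-(n+1) cube-site s, x + e_μ in a scale-n cube-site t: t lies against the face of
outward normal +e_μ of s): one Λ_{n+1}-bond from the corner of s reaches the scale-n cube at the far corner of that face —
THE BOND OF THE COARSER LATTICE ACROSS THE INTERFACE (reading R0) —, which is joined to t by Λ_n-bonds along the face.
[cite: Balaban1984PropagatorsII, (2.46) p.231] -/
private theorem reachable_of_step_down {M : ℕ} (hmono : Monotone Z) (hsep : LayerSepZd Z M L) (ht : Tiles M₁ L Z)
    (hM₁ : 0 < M₁) (hM : M₁ ≤ M) (hL : 2 ≤ L) {n : ℕ} {s t : CubeSite M₁ L Z} (hsn : s.1.1 = n + 1)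
    (htn : t.1.1 = n) {x : Fin d → ℤ} {μ : Fin d} (hx : x ∈ cube M₁ L s.1.1 s.1.2)
    (hy : Function.update x μ (x μ + 1) ∈ cube M₁ L t.1.1 t.1.2) : (latC M₁ L Z).Reachable s t := by
  classical
  have hL0 : 0 < L := by omega
  have hst : s ≠ t := fun h => by rw [h, htn] at hsn; omega
  obtain ⟨hF1, hF2⟩ := face_eqs hmono hM₁ hL0 hst hx hy
  have hx' := (mem_cube (M₁ := M₁)).mp hx
  have hy' := (mem_cube (M₁ := M₁)).mp hy
  rw [hsn] at hF1 hx'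
  rw [htn] at hF2 hy'
  set S : ℤ := ((M₁ * L ^ n : ℕ) : ℤ) with hSdef
  set S' : ℤ := ((M₁ * L ^ (n + 1) : ℕ) : ℤ) with hS'def
  set c := s.1.2 with hcdef
  set c' := t.1.2 with hc'def
  set F := x μ + 1 with hFdef
  have hSpos : 0 < M₁ * L ^ n := Nat.mul_pos hM₁ (Nat.pow_pos hL0)
  have hS0 : (0 : ℤ) < S := by rw [hSdef]; exact_mod_cast hSpos
  have hS1 : (1 : ℤ) ≤ S := hS0
  have hSS : S' = S * (L : ℤ) := by rw [hS'def, hSdef]; push_cast; ring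
  have hL1 : (1 : ℤ) ≤ (L : ℤ) := by exact_mod_cast hL0
  have hSle : S ≤ S' := by rw [hSS]; nlinarith
  -- the slab of thickness S above the face x_μ = F of s
  let W : Set (Fin d → ℤ) :=
    {z | F ≤ z μ ∧ z μ < F + S ∧ ∀ ν, ν ≠ μ → S' * c ν ≤ z ν ∧ z ν < S' * (c ν + 1)}
  have hWB : W ⊆ cube M₁ L (n + 1) (Function.update c μ (c μ + 1)) := by
    intro z hz
    obtain ⟨hz1, hz2, hz3⟩ := hz
    rw [mem_cube]
    intro ν
    by_cases hν : ν = μ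
    · subst hν
      rw [Function.update_self, ← hS'def]
      constructor <;> nlinarith
    · rw [Function.update_of_ne hν, ← hS'def]
      exact hz3 ν hν
  have hnear : ∀ z ∈ W, ∃ b ∈ cube M₁ L s.1.1 s.1.2, dist (toR z) (toR b) ≤ ((M₁ * L ^ n : ℕ) : ℝ) := by
    intro z hz
    obtain ⟨hz1, hz2, hz3⟩ := hz
    refine ⟨Function.update z μ (F - 1), ?_, ?_⟩
    · rw [hsn, mem_cube]
      intro ν
      by_cases hν : ν = μ
      · subst hν
        rw [Function.update_self, ← hS'def]
        constructor <;> nlinarith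
      · rw [Function.update_of_ne hν, ← hS'def]
        exact hz3 ν hν
    · apply dist_update_le (by positivity)
      rw [abs_le]
      have e : (((M₁ * L ^ n : ℕ) : ℝ)) = ((S : ℤ) : ℝ) := by rw [hSdef]; push_cast; ring
      rw [e]
      constructor
      · have : ((F : ℤ) : ℝ) ≤ ((z μ : ℤ) : ℝ) := by exact_mod_cast hz1
        have : (0 : ℝ) ≤ ((S : ℤ) : ℝ) := by exact_mod_cast hS0.le
        push_cast
        linarith
      · have : z μ - (F - 1) ≤ S := by omega
        have : ((z μ : ℤ) : ℝ) - (((F : ℤ) : ℝ) - 1) ≤ ((S : ℤ) : ℝ) := by exact_mod_cast this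
        push_cast
        linarith
  have hyW : Function.update x μ F ∈ W := by
    refine ⟨by rw [Function.update_self], by rw [Function.update_self]; omega, fun ν hν => ?_⟩
    rw [Function.update_of_ne hν]
    exact hx' ν
  have hlayer := layer_of_near hmono hsep ht hM₁ hM hL s hsn _ hWB hnear (s := t) htn hy hyW
  -- the box of scale-n cubes above that face
  let lo : Fin d → ℤ := Function.update (fun ν => (L : ℤ) * c ν) μ ((L : ℤ) * (c μ + 1))
  let hi : Fin d → ℤ := Function.update (fun ν => (L : ℤ) * c ν + L - 1) μ ((L : ℤ) * (c μ + 1))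
  have hbox : ∀ e : Fin d → ℤ, (∀ ν, lo ν ≤ e ν ∧ e ν ≤ hi ν) → cube M₁ L n e ⊆ Z (n + 1) \ Z n := by
    intro e he z hz
    apply hlayer z
    rw [mem_cube, ← hSdef] at hz
    have heμ : e μ = (L : ℤ) * (c μ + 1) := by
      have h := he μ
      simp only [lo, hi, Function.update_self] at h
      omega
    refine ⟨?_, ?_, fun ν hν => ?_⟩
    · have := (hz μ).1
      rw [heμ] at this
      have e1 : S * ((L : ℤ) * (c μ + 1)) = S' * (c μ + 1) := by rw [hSS]; ring
      linarith
    · have := (hz μ).2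
      rw [heμ] at this
      have e1 : S * ((L : ℤ) * (c μ + 1) + 1) = S' * (c μ + 1) + S := by rw [hSS]; ring
      linarith
    · have h := he ν
      simp only [lo, hi, Function.update_of_ne hν] at h
      have h1 := (hz ν).1
      have h2 := (hz ν).2
      rw [hSS]
      constructor <;> nlinarith
  have htbox : ∀ ν, lo ν ≤ c' ν ∧ c' ν ≤ hi ν := by
    intro ν
    by_cases hν : ν = μ
    · subst hν
      simp only [lo, hi, Function.update_self]
      have e1 : S * c' ν = S * ((L : ℤ) * (c ν + 1)) := by rw [← hF2, hF1, hSS]; ring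
      have := mul_left_cancel₀ hS0.ne' e1
      omega
    · simp only [lo, hi, Function.update_of_ne hν]
      have h1 := hx' ν
      have h2 := hy' ν
      rw [Function.update_of_ne hν] at h2
      rw [hSS] at h1
      have ea : S * ((L : ℤ) * c ν) = S * (L : ℤ) * c ν := by ring
      have eb : S * ((L : ℤ) * c ν + L - 1 + 1) = S * (L : ℤ) * (c ν + 1) := by ring
      have a : (L : ℤ) * c ν ≤ c' ν := idx_le_of_bounds hS0 (by rw [ea]; exact h1.1) h2.2
      have b : c' ν ≤ (L : ℤ) * c ν + L - 1 := idx_le_of_bounds hS0 h2.1 (by rw [eb]; exact h1.2)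
      exact ⟨a, b⟩
  -- the scale-n cube at the end of the Λ_{n+1}-bond from the corner of s
  have hlo : ∀ ν, lo ν ≤ lo ν ∧ lo ν ≤ hi ν := by
    intro ν
    by_cases hν : ν = μ
    · subst hν
      simp only [lo, hi, Function.update_self]
      omega
    · simp only [lo, hi, Function.update_of_ne hν]
      constructor <;> nlinarith
  let f : CubeSite M₁ L Z := ⟨(n, lo), hbox lo hlo⟩
  have h1 : (latC M₁ L Z).Reachable f t := reachable_in_box n lo hi hbox f t rfl htn hlo htbox
  have h2 : (latC M₁ L Z).Adj s f := by
    refine latC_adj.mpr ⟨fun h => ?_, Or.inl ⟨μ, funext fun ν => ?_⟩⟩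
    · have h' : s.1.1 = f.1.1 := congrArg (fun w : CubeSite M₁ L Z => w.1.1) h
      change s.1.1 = n at h'
      omega
    · rw [Pi.add_apply, cornerC_apply, cornerC_apply]
      unfold zoneC sideZ
      rw [hsn]
      change S * lo ν = S' * c ν + (Pi.single μ S' : Fin d → ℤ) ν
      by_cases hν : ν = μ
      · subst hν
        simp only [lo, Function.update_self, Pi.single_eq_same]
        rw [hSS]
        ring
      · simp only [lo, Function.update_of_ne hν, Pi.single_eq_of_ne hν, add_zero]
        rw [hSS]
        ring
  exact h2.reachable.trans h1

/-- **Lattice points one unit step apart lie in cube-sites joined by a lattice contour** (the three cases: same scale,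
into a coarser cube, into a finer cube; scales of cubes sharing a face differ by at most one, `zone_le_succ_of_touching`).
[cite: Balaban1984PropagatorsII, (2.46) p.231] -/
theorem reachable_of_adjacent_points {M : ℕ} (hmono : Monotone Z) (hsep : LayerSepZd Z M L) (ht : Tiles M₁ L Z)
    (hM₁ : 0 < M₁) (hM : M₁ ≤ M) (hL : 2 ≤ L) {s t : CubeSite M₁ L Z} {x : Fin d → ℤ} {μ : Fin d}
    (hx : x ∈ cube M₁ L s.1.1 s.1.2) (hy : Function.update x μ (x μ + 1) ∈ cube M₁ L t.1.1 t.1.2) :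
    (latC M₁ L Z).Reachable s t := by
  by_cases hst : s = t
  · subst hst
    rfl
  have hL0 : 0 < L := by omega
  have hM' : 1 ≤ M := le_trans hM₁ hM
  have htouch : Touching s t := ⟨x, hx, _, hy, by
    have := dist_toR_update_le_one x μ (x μ)
    rwa [Function.update_eq_self] at this⟩
  have h1 := zone_le_succ_of_touching hmono hsep hM' hL htouch
  have h2 := zone_le_succ_of_touching hmono hsep hM' hL (touching_symm htouch)
  unfold zoneC at h1 h2
  obtain h | h | h : t.1.1 = s.1.1 ∨ t.1.1 = s.1.1 + 1 ∨ s.1.1 = t.1.1 + 1 := by omega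
  · exact (adj_of_step_same hmono hM₁ hL0 hst h hx hy).reachable
  · exact reachable_of_step_up hmono hsep ht hM₁ hM hL rfl h hx hy
  · exact reachable_of_step_down hmono hsep ht hM₁ hM hL h rfl hx hy

section Chosen

variable {M : ℕ} (hmono : Monotone Z) (hsep : LayerSepZd Z M L) (ht : Tiles M₁ L Z) (hM₁ : 0 < M₁) (hM : M₁ ≤ M)
  (hL : 2 ≤ L) (σ : (Fin d → ℤ) → CubeSite M₁ L Z) (hσ : ∀ x, x ∈ cube M₁ L (σ x).1.1 (σ x).1.2)
include hmono hsep ht hM₁ hM hL hσ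

/-- Moving one coordinate up by `m` unit steps keeps the chosen cube-sites in one component. [folklore] -/
private theorem reachable_update_add (x : Fin d → ℤ) (μ : Fin d) (v : ℤ) :
    ∀ m : ℕ, (latC M₁ L Z).Reachable (σ (Function.update x μ v)) (σ (Function.update x μ (v + m)))
  | 0 => by simp
  | m + 1 => by
    refine (reachable_update_add x μ v m).trans
      (reachable_of_adjacent_points hmono hsep ht hM₁ hM hL (μ := μ) (hσ _) ?_)
    have e : Function.update (Function.update x μ (v + m)) μ (Function.update x μ (v + m) μ + 1) =
        Function.update x μ (v + ((m + 1 : ℕ) : ℤ)) := by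
      rw [Function.update_self, Function.update_idem]
      push_cast
      ring_nf
    rw [e]
    exact hσ _

/-- Changing one coordinate arbitrarily keeps the chosen cube-sites in one component. [folklore] -/
private theorem reachable_update (x : Fin d → ℤ) (μ : Fin d) (w : ℤ) :
    (latC M₁ L Z).Reachable (σ x) (σ (Function.update x μ w)) := by
  rcases le_total (x μ) w with h | h
  · obtain ⟨m, hm⟩ := Int.le.dest h
    have := reachable_update_add hmono hsep ht hM₁ hM hL σ hσ x μ (x μ) m
    rwa [Function.update_eq_self, hm] at this
  · obtain ⟨m, hm⟩ := Int.le.dest h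
    have := reachable_update_add hmono hsep ht hM₁ hM hL σ hσ x μ w m
    rw [hm, Function.update_eq_self] at this
    exact this.symm

/-- Any two lattice points have chosen cube-sites in one component (`ℤᵈ` is connected by unit steps). [folklore] -/
private theorem reachable_chosen (x y : Fin d → ℤ) : (latC M₁ L Z).Reachable (σ x) (σ y) := by
  classical
  suffices H : ∀ (T : Finset (Fin d)) (x y : Fin d → ℤ), (∀ ν, ν ∉ T → x ν = y ν) →
      (latC M₁ L Z).Reachable (σ x) (σ y) from
    H Finset.univ x y (fun ν hν => absurd (Finset.mem_univ ν) hν)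
  intro T
  induction T using Finset.induction_on with
  | empty =>
    intro x y h
    rw [show x = y from funext fun ν => h ν (Finset.notMem_empty ν)]
  | @insert μ T _ ih =>
    intro x y h
    refine (reachable_update hmono hsep ht hM₁ hM hL σ hσ x μ (y μ)).trans (ih _ y fun ν hν => ?_)
    by_cases hνμ : ν = μ
    · subst hνμ
      simp
    · rw [Function.update_of_ne hνμ]
      exact h ν (by simp [hνμ, hν])

end Chosen

/-- **THE LATTICE CONTOUR GRAPH IS CONNECTED** (nested `Z″`, one separating layer, the covering (2.4), `M₁ ≤ M`, `M₁ ≥ 1`,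
`L ≥ 2`): print's admissible contours, read literally (R0), JOIN ANY TWO BLOCKS OF THE GENERATING SET — so (2.46) is a
genuine minimum and `B6Decomp247LatticeTwoSided.decomp247` applies.  Through the +e_μ faces of the coarse regions these
contours use the bonds of the coarser lattice; the one-sided reading R1 has no bond there at all.
[cite: Balaban1984PropagatorsII, (2.4) p.224, (2.46) p.231; Balaban1989LargeFieldI, p.179] -/
theorem latC_connected {M : ℕ} (hmono : Monotone Z) (hsep : LayerSepZd Z M L) (ht : Tiles M₁ L Z) (hM₁ : 0 < M₁)
    (hM : M₁ ≤ M) (hL : 2 ≤ L) : (latC M₁ L Z).Connected := by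
  have hL0 : 0 < L := by omega
  choose σ hσ using ht
  have ht' : Tiles M₁ L Z := fun x => ⟨σ x, hσ x⟩
  haveI : Nonempty (CubeSite M₁ L Z) := ⟨σ fun _ => 0⟩
  have hs : ∀ u : CubeSite M₁ L Z, σ (cornerC u) = u := fun u =>
    site_eq_of_mem hmono hM₁ hL0 (hσ _) (corner_mem_cube (Nat.mul_pos hM₁ (Nat.pow_pos hL0)) _)
  refine ⟨fun s t => ?_⟩
  have := reachable_chosen hmono hsep ht' hM₁ hM hL σ hσ (cornerC s) (cornerC t)
  rwa [hs, hs] at this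

end Connected

/-! ## §4 Lemma 2.1 with the d-only constant for every geometry realised by the lattice contours of a cube model -/

section Instances

variable [NeZero d] {g : B6.Geometry} {M : ℕ}

/-- The lattice contour system of a geometry whose generating set is embedded in the cube-sites (zones = scales).
[cite: Balaban1984PropagatorsII, (2.45)–(2.46) p.231] -/
@[reducible] def latSystem (ι : g.Site → CubeSite M₁ L Z) (hzone : ∀ y, zoneC (ι y) = g.scale y) : ContourSystem g :=
  ⟨CubeSite M₁ L Z, latC M₁ L Z, ι, zoneC, hzone⟩

/-- **(2.61″) WITH c₁″ = 13c₀(½α)^{4d} FOR EVERY GEOMETRY REALISED BY THE LATTICE CONTOURS OF A NESTED CUBE MODEL**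
(print's distance (2.46) read literally, R0): `Ineq261With (c1TwoScale d δ₀ α) g δ₀ α` under (2.59), for 𝔅 embedded in
the cube-sites with its zones (`ι`, `hzone`), `g.dist` = the lattice-contour distance, nested `Z″` with one separating layer
and the covering (2.4) (`Tiles`), `1 ≤ M₁ ≤ M`, `L ≥ 2`, `RM ≤ M/M₁` and `2 ≤ M/M₁` —
`B6Decomp247LatticeTwoSided.ineq261T_of_twoSidedDrawing` on `latDrawing`, with `Separates`/`LevelGap` from §1 and the
connectedness of §3; NO graph-theoretic hypothesis left. [cite: Balaban1984PropagatorsII, Lemma 2.1 (2.61) p.234, (2.2) p.224; Balaban1989LargeFieldI, p.179, p.186; corrected] -/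
theorem ineq261T_latC (ι : g.Site → CubeSite M₁ L Z) (hι : Function.Injective ι)
    (hzone : ∀ y, zoneC (ι y) = g.scale y) (hdist : ∀ y y', g.dist y y' = ((latC M₁ L Z).dist (ι y) (ι y') : ℝ))
    (hmono : Monotone Z) (hsep : LayerSepZd Z M L) (ht : Tiles M₁ L Z) (hM₁ : 0 < M₁) (hM : M₁ ≤ M)
    (hL : 2 ≤ L) (hRM : g.R * g.M ≤ ((M / M₁ : ℕ) : ℝ)) (hN : 2 ≤ M / M₁) {δ₀ α : ℝ} (hα : 0 < α) (hδ : 0 < δ₀)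
    (h259 : B6.Cond259 d δ₀ α g.R g.M) :
    B6Lemma21Repaired.Ineq261With (B6Lemma21TwoScale.c1TwoScale d δ₀ α) g δ₀ α :=
  B6Decomp247LatticeTwoSided.ineq261T_of_twoSidedDrawing (C := latSystem ι hzone) (A := Fin d → ℤ)
    (latDrawing hmono hM₁ (by omega)) (fun y y' => hdist y y') (latC_connected hmono hsep ht hM₁ hM hL)
    (separates_latC hmono hsep hM₁ (le_trans hM₁ hM) hL) (levelGap_latC hmono hsep hM₁ hL) hRM hN hι hα hδ h259

/-- **THE ROW SUM AS A NUMBER** for such a geometry: `Σ_{y′∈𝔅} e^{−αδ₀d(y,y′)} ≤ 13c₀(½α)^{4d}` at every base point —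
independent of L, of the number of scales and of the nested family `Z″`. [cite: Balaban1984PropagatorsII, (2.61) p.234; corrected] -/
theorem sum_exp_le_latC (ι : g.Site → CubeSite M₁ L Z) (hι : Function.Injective ι)
    (hzone : ∀ y, zoneC (ι y) = g.scale y) (hdist : ∀ y y', g.dist y y' = ((latC M₁ L Z).dist (ι y) (ι y') : ℝ))
    (hmono : Monotone Z) (hsep : LayerSepZd Z M L) (ht : Tiles M₁ L Z) (hM₁ : 0 < M₁) (hM : M₁ ≤ M)
    (hL : 2 ≤ L) (hRM : g.R * g.M ≤ ((M / M₁ : ℕ) : ℝ)) (hN : 2 ≤ M / M₁) {δ₀ α : ℝ} (hα : 0 < α) (hδ : 0 < δ₀)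
    (h259 : B6.Cond259 d δ₀ α g.R g.M) (y : g.Site) :
    ∑ y' : g.Site, Real.exp (-(α * δ₀ * g.dist y y')) ≤ 13 * B6.c0 δ₀ (α / 2) ^ (4 * d) :=
  ineq261T_latC ι hι hzone hdist hmono hsep ht hM₁ hM hL hRM hN hα hδ h259 y

end Instances

/-! ## §5 The lattice-contour geometry whose sites ARE cube-sites: the named inhabited instance of reading R0 -/

section Geo

/-- **The lattice-contour geometry** on a finite set `F` of cube-sites of the ℤᵈ model: `𝔅 = F`, scale = the scale of the
cube, distance = print's (2.46) read literally (R0: the least number of bonds of `latC`, contours may leave `F`), parameters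
as given; the localisation vocabulary of Props. 2.2–2.8 is not used by Lemma 2.1 and is filled trivially (as in
`B15TouchingCubeContours.touchGeo`, the R2 sibling). [cite: Balaban1984PropagatorsII, (2.1)–(2.4) p.224, (2.45)–(2.46) p.231; Balaban1989LargeFieldI, p.179, p.186] -/
@[reducible] noncomputable def latGeo (M₁ L : ℕ) (Z : ℕ → Set (Fin d → ℤ)) (F : Finset (CubeSite M₁ L Z))
    (kk : ℕ) (η R Mr : ℝ) : B6.Geometry where
  Site := ↥F
  fin := inferInstance
  scale := fun y => zoneC y.1
  dist := fun y y' => ((latC M₁ L Z).dist y.1 y'.1 : ℝ)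
  k := kk
  eta := η
  L := L
  R := R
  M := Mr
  Hyp21_22 := True
  Loc := PUnit
  suppIn := fun _ _ => True
  supNorm := fun _ => 0
  l2Norm := fun _ => 0
  holder := fun _ _ => 0
  Cut := PUnit
  cutIn := fun _ _ => True
  cutH := fun _ _ => 0
  cutSup := fun _ => 0

variable (F : Finset (CubeSite M₁ L Z)) (kk : ℕ) (η R Mr : ℝ)

/-- Its distance IS (2.46) of the lattice contour system (by construction). [cite: Balaban1984PropagatorsII, (2.46) p.231] -/
theorem realizes_latGeo :
    Realizes (latGeo M₁ L Z F kk η R Mr) (latSystem (g := latGeo M₁ L Z F kk η R Mr) Subtype.val fun _ => rfl) :=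
  fun _ _ => rfl

/-- **(2.61″) FOR THE LATTICE-CONTOUR GEOMETRY OF A NESTED CUBE FAMILY, d-ONLY CONSTANT, PRINT'S DISTANCE READ LITERALLY**:
no hypothesis left beyond the shape of `Z″` (`Monotone`, one separating layer `LayerSepZd Z″ M L`, the covering `Tiles`),
`1 ≤ M₁ ≤ M`, `L ≥ 2`, `R·Mr ≤ M/M₁`, `2 ≤ M/M₁` and (2.59). [cite: Balaban1984PropagatorsII, Lemma 2.1 (2.61) p.234; Balaban1989LargeFieldI, p.179, p.186; corrected] -/
theorem ineq261T_latGeo [NeZero d] {M : ℕ} (hmono : Monotone Z) (hsep : LayerSepZd Z M L) (ht : Tiles M₁ L Z) (hM₁ : 0 < M₁)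
    (hM : M₁ ≤ M) (hL : 2 ≤ L) (hRM : R * Mr ≤ ((M / M₁ : ℕ) : ℝ)) (hN : 2 ≤ M / M₁) {δ₀ α : ℝ} (hα : 0 < α)
    (hδ : 0 < δ₀) (h259 : B6.Cond259 d δ₀ α R Mr) :
    B6Lemma21Repaired.Ineq261With (B6Lemma21TwoScale.c1TwoScale d δ₀ α) (latGeo M₁ L Z F kk η R Mr) δ₀ α :=
  ineq261T_latC (g := latGeo M₁ L Z F kk η R Mr) Subtype.val Subtype.val_injective (fun _ => rfl) (fun _ _ => rfl)
    hmono hsep ht hM₁ hM hL hRM hN hα hδ h259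

/-- **ALL FOUR DISPLAYS (2.60)–(2.63) OF LEMMA 2.1 WITH c₁″ for the lattice-contour geometry** (0 < α < 1, (2.59)).
[cite: Balaban1984PropagatorsII, Lemma 2.1 (2.60)–(2.63) p.234; corrected] -/
theorem lemma21_full_latGeo [NeZero d] {M : ℕ} (hmono : Monotone Z) (hsep : LayerSepZd Z M L) (ht : Tiles M₁ L Z) (hM₁ : 0 < M₁)
    (hM : M₁ ≤ M) (hL : 2 ≤ L) (hRM : R * Mr ≤ ((M / M₁ : ℕ) : ℝ)) (hN : 2 ≤ M / M₁) {δ₀ : ℝ} (hδ : 0 < δ₀) :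
    ∀ α : ℝ, 0 < α → α < 1 → B6.Cond259 d δ₀ α R Mr →
      B6RandomWalk.Ineq260 (latGeo M₁ L Z F kk η R Mr) δ₀ α ∧
        B6Lemma21Repaired.Ineq261With (B6Lemma21TwoScale.c1TwoScale d δ₀ α) (latGeo M₁ L Z F kk η R Mr) δ₀ α ∧
        B6Lemma21Repaired.Ineq262With (B6Lemma21TwoScale.c1TwoScale d δ₀ α) (latGeo M₁ L Z F kk η R Mr) δ₀ α ∧
        B6Lemma21Repaired.Ineq263With (B6Lemma21TwoScale.c1TwoScale d δ₀ α) (latGeo M₁ L Z F kk η R Mr) δ₀ α :=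
  fun α hα0 hα1 h259 =>
    B6Decomp247LatticeTwoSided.lemma21_full_of_twoSidedDrawing d δ₀ hδ (fun _ : PUnit => latGeo M₁ L Z F kk η R Mr)
      (fun _ => latSystem (g := latGeo M₁ L Z F kk η R Mr) Subtype.val fun _ => rfl) (fun _ => M / M₁)
      (fun _ => Fin d → ℤ) (fun _ => latDrawing hmono hM₁ (by omega)) (fun _ _ _ => rfl)
      (fun _ => latC_connected hmono hsep ht hM₁ hM hL) (fun _ => separates_latC hmono hsep hM₁ (le_trans hM₁ hM) hL)
      (fun _ => levelGap_latC hmono hsep hM₁ hL) (fun _ => hRM) (fun _ => hN) (fun _ => Subtype.val_injective)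
      PUnit.unit trivial α hα0 hα1 h259

end Geo

/-! ## §6 Over ANY [III]-admissible sequence, and over the nested boxes with numerics only -/

section Admissible

variable [NeZero d] {M : ℕ} {D : ℕ → Set (Fin d → ℤ)}

/-- **LEMMA 2.1 (2.60)–(2.63) WITH THE d-ONLY CONSTANT c₁″ FOR PRINT'S DISTANCE (2.46) READ LITERALLY, OVER ANY ADMISSIBLE
SEQUENCE OF DOMAINS** completed to the whole lattice (`Z″ = Ωᶜ`): hypotheses = r11's admissibility data ([III] (2.13)
separation `hdistD`, every Ω_n a union of LⁿM-cubes), `Ω₀ = T`, termination, and the numerics `1 ≤ M₁`, `M₁ ∣ M`,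
`L ≥ 2`, `R·M_r ≤ M/M₁`, `2 ≤ M/M₁`, `δ₀ > 0`, 0 < α < 1, (2.59) — `Monotone`/`LayerSepZd` by `B15Ineq147Admissible`,
`Tiles` by `B15TouchingCubeDomains.tiles_of_admissible`, connectedness by `latC_connected`.  Compare the R2 sibling
`B15TouchingCubeDomains.lemma21_admissible` (touching cubes, L-DEPENDENT constant `K261`).
[cite: Balaban1984PropagatorsII, Lemma 2.1 (2.60)–(2.63) p.234, (2.1)–(2.4) p.224, (2.46) p.231; Balaban1988Convergent, (2.13) p.256; Balaban1989LargeFieldI, p.179; corrected] -/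
theorem lemma21_full_latGeo_admissible
    (hdistD : ∀ n, ∀ x ∈ D (n + 1), ∀ y, Within ((B14.Eq213MaximalDomains.side L M (n + 1) : ℤ) - 1) x y → y ∈ D n)
    (hcubes : ∀ n, IsUnionOfCubes (B14.Eq213MaximalDomains.side L M n) (D n)) (h0 : D 0 = Set.univ)
    (hex : ∀ x, ∃ n, x ∉ D n) (hM₁ : 0 < M₁) (hM : 1 ≤ M) (hdvd : M₁ ∣ M) (hL : 2 ≤ L)
    (F : Finset (CubeSite M₁ L (fun n => (D n)ᶜ))) (kk : ℕ) (η R Mr : ℝ) (hRM : R * Mr ≤ ((M / M₁ : ℕ) : ℝ))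
    (hN : 2 ≤ M / M₁) {δ₀ : ℝ} (hδ : 0 < δ₀) :
    ∀ α : ℝ, 0 < α → α < 1 → B6.Cond259 d δ₀ α R Mr →
      B6RandomWalk.Ineq260 (latGeo M₁ L (fun n => (D n)ᶜ) F kk η R Mr) δ₀ α ∧
        B6Lemma21Repaired.Ineq261With (B6Lemma21TwoScale.c1TwoScale d δ₀ α)
          (latGeo M₁ L (fun n => (D n)ᶜ) F kk η R Mr) δ₀ α ∧
        B6Lemma21Repaired.Ineq262With (B6Lemma21TwoScale.c1TwoScale d δ₀ α)
          (latGeo M₁ L (fun n => (D n)ᶜ) F kk η R Mr) δ₀ α ∧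
        B6Lemma21Repaired.Ineq263With (B6Lemma21TwoScale.c1TwoScale d δ₀ α)
          (latGeo M₁ L (fun n => (D n)ᶜ) F kk η R Mr) δ₀ α :=
  lemma21_full_latGeo F kk η R Mr (monotone_compl_of_admissible (by omega) hM hdistD) (layerSepZd_of_admissible hdistD)
    (tiles_of_admissible hM₁ (by omega) hdvd hcubes h0 hex) hM₁ (Nat.le_of_dvd hM hdvd) hL hRM hN hδ

variable {K : ℕ}

/-- **LEMMA 2.1 (2.60)–(2.63) WITH c₁″ FOR THE LATTICE-CONTOUR GEOMETRY OVER THE NESTED BOXES — NUMERICS ONLY**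
(`B15TouchingCubeDomains.nestedZ M₁ K L`: `d ≥ 1`, `M₁ ≥ 1`, `K ≥ 2`, `L ≥ 2`, `R·M_r ≤ K`, `δ₀ > 0`, 0 < α < 1,
(2.59)): every geometric and graph-theoretic hypothesis discharged — the named inhabited instance of reading R0 with bonds
of the coarser lattice across interfaces (non-vacuity of `B6Decomp247LatticeTwoSided` beyond the towers).
[cite: Balaban1984PropagatorsII, Lemma 2.1 (2.60)–(2.63) p.234; Balaban1989LargeFieldI, p.179; corrected] -/
theorem lemma21_full_latGeo_nestedZ (hM₁ : 0 < M₁) (hK : 2 ≤ K) (hL : 2 ≤ L)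
    (F : Finset (CubeSite M₁ L (nestedZ (d := d) M₁ K L))) (kk : ℕ) (η R Mr : ℝ) (hRM : R * Mr ≤ (K : ℝ))
    {δ₀ : ℝ} (hδ : 0 < δ₀) :
    ∀ α : ℝ, 0 < α → α < 1 → B6.Cond259 d δ₀ α R Mr →
      B6RandomWalk.Ineq260 (latGeo M₁ L (nestedZ M₁ K L) F kk η R Mr) δ₀ α ∧
        B6Lemma21Repaired.Ineq261With (B6Lemma21TwoScale.c1TwoScale d δ₀ α)
          (latGeo M₁ L (nestedZ M₁ K L) F kk η R Mr) δ₀ α ∧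
        B6Lemma21Repaired.Ineq262With (B6Lemma21TwoScale.c1TwoScale d δ₀ α)
          (latGeo M₁ L (nestedZ M₁ K L) F kk η R Mr) δ₀ α ∧
        B6Lemma21Repaired.Ineq263With (B6Lemma21TwoScale.c1TwoScale d δ₀ α)
          (latGeo M₁ L (nestedZ M₁ K L) F kk η R Mr) δ₀ α := by
  have hd : 0 < d := Nat.pos_of_ne_zero (NeZero.ne d)
  have hdiv : M₁ * K / M₁ = K := Nat.mul_div_cancel_left K hM₁
  refine lemma21_full_latGeo F kk η R Mr (M := M₁ * K) (monotone_nestedZ (by omega)) (layerSepZd_nestedZ (by omega))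
    (tiles_nestedZ hd hM₁ (by omega) (by omega)) hM₁ (Nat.le_mul_of_pos_right M₁ (by omega)) hL ?_ ?_ hδ
  · rw [hdiv]; exact hRM
  · rw [hdiv]; exact hK

end Admissible

/-! ## §7 (v1.1, theorems only) d_R2 ≤ d_R0, and Lemma 2.1 with ONE d-only constant UNIFORMLY over FAMILIES of
lattice-contour geometries (the shape `B6Lemma21TwoScale.Lemma21TwoScale` / `DagBinding.B6Lemma21Param` consumers bind) -/

section Family

/-- Distances can only grow when bonds are removed: for `G ≤ G'` and u, v joined in G, `dist_{G'} ≤ dist_G`.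
[cite: Balaban1984PropagatorsII, (2.46) p.231] -/
theorem dist_anti {V : Type*} {G G' : SimpleGraph V} (h : G ≤ G') {u v : V} (hr : G.Reachable u v) :
    G'.dist u v ≤ G.dist u v := by
  obtain ⟨p, hp⟩ := hr.exists_walk_length_eq_dist
  have h2 : (p.mapLe h).length = p.length := by
    have a := (p.mapLe h).length_support
    have b := p.length_support
    rw [SimpleGraph.Walk.support_mapLe_eq_support] at a
    omega
  have := SimpleGraph.dist_le (p.mapLe h)
  omega

/-- **d_R2 ≤ d_R0 on the cube carrier** (GAPS G-B6-22: every lattice bond joins touching cubes, so the touching-contour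
distance is at most the lattice-contour distance; `latC` connected). [cite: Balaban1984PropagatorsII, (2.46) p.231] -/
theorem touchC_dist_le_latC_dist {M : ℕ} (hmono : Monotone Z) (hsep : LayerSepZd Z M L) (ht : Tiles M₁ L Z)
    (hM₁ : 0 < M₁) (hM : M₁ ≤ M) (hL : 2 ≤ L) (s t : CubeSite M₁ L Z) :
    (touchC M₁ L Z).dist s t ≤ (latC M₁ L Z).dist s t :=
  dist_anti (latC_le_touchC hM₁ (by omega)) (latC_connected hmono hsep ht hM₁ hM hL s t)

variable [NeZero d] {I : Type}

/-- **LEMMA 2.1 (TWO-SCALE CONSTANT) UNIFORMLY OVER ANY FAMILY OF LATTICE-CONTOUR GEOMETRIES OF NESTED CUBE MODELS**: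
`B6Lemma21TwoScale.Lemma21TwoScale d δ₀ geo` — ONE constant c₁″(α) = 13c₀(½α)^{4d} for the whole family (all members'
`Z″`, site sets, numbers of scales, L, M₁, M, R, M_r may vary with the index; per member: nested `Z″`, one separating
layer, the covering, `1 ≤ M₁ ≤ M`, `L ≥ 2`, `R·M_r ≤ M/M₁`, `2 ≤ M/M₁`) — the shape consumed by
`DagBinding.b6Lemma21Param_of_twoScale` (the UNIFORMITY over an infinite family that `B6Lemma21Param` asks for).
[cite: Balaban1984PropagatorsII, Lemma 2.1 (2.60)–(2.61) p.234; Balaban1989LargeFieldI, p.179; corrected] -/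
theorem lemma21TwoScale_latGeo_family {δ₀ : ℝ} (hδ : 0 < δ₀) (M₁ L M : I → ℕ)
    (Z : I → ℕ → Set (Fin d → ℤ)) (F : ∀ i, Finset (CubeSite (M₁ i) (L i) (Z i))) (kk : I → ℕ) (η R Mr : I → ℝ)
    (hmono : ∀ i, Monotone (Z i)) (hsep : ∀ i, LayerSepZd (Z i) (M i) (L i)) (ht : ∀ i, Tiles (M₁ i) (L i) (Z i))
    (hM₁ : ∀ i, 0 < M₁ i) (hM : ∀ i, M₁ i ≤ M i) (hL : ∀ i, 2 ≤ L i)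
    (hRM : ∀ i, R i * Mr i ≤ ((M i / M₁ i : ℕ) : ℝ)) (hN : ∀ i, 2 ≤ M i / M₁ i) :
    B6Lemma21TwoScale.Lemma21TwoScale d δ₀ (fun i => latGeo (M₁ i) (L i) (Z i) (F i) (kk i) (η i) (R i) (Mr i)) :=
  B6Decomp247LatticeTwoSided.lemma21TwoScale_of_twoSidedDrawing d δ₀ hδ _
    (fun i => latSystem (g := latGeo (M₁ i) (L i) (Z i) (F i) (kk i) (η i) (R i) (Mr i)) Subtype.val fun _ => rfl)
    (fun i => M i / M₁ i) (fun _ => Fin d → ℤ) (fun i => latDrawing (hmono i) (hM₁ i) (by have := hL i; omega))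
    (fun _ _ _ => rfl) (fun i => latC_connected (hmono i) (hsep i) (ht i) (hM₁ i) (hM i) (hL i))
    (fun i => separates_latC (hmono i) (hsep i) (hM₁ i) (le_trans (hM₁ i) (hM i)) (hL i))
    (fun i => levelGap_latC (hmono i) (hsep i) (hM₁ i) (hL i)) hRM hN (fun _ => Subtype.val_injective)

/-- **The same over any family of [III]-admissible sequences** (member i: r11's admissibility data for `D i`, `Ω₀ = T`,
termination, `M₁ ∣ M`, `L ≥ 2`, `R·M_r ≤ M/M₁`, `2 ≤ M/M₁`; common d, δ₀): one d-only constant for all of them.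
[cite: Balaban1984PropagatorsII, Lemma 2.1 (2.60)–(2.61) p.234; Balaban1988Convergent, (2.13) p.256; corrected] -/
theorem lemma21TwoScale_latGeo_admissible_family {δ₀ : ℝ} (hδ : 0 < δ₀) (M₁ L M : I → ℕ)
    (D : I → ℕ → Set (Fin d → ℤ))
    (hdistD : ∀ i n, ∀ x ∈ D i (n + 1), ∀ y,
      Within ((B14.Eq213MaximalDomains.side (L i) (M i) (n + 1) : ℤ) - 1) x y → y ∈ D i n)
    (hcubes : ∀ i n, IsUnionOfCubes (B14.Eq213MaximalDomains.side (L i) (M i) n) (D i n))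
    (h0 : ∀ i, D i 0 = Set.univ) (hex : ∀ i x, ∃ n, x ∉ D i n) (hM₁ : ∀ i, 0 < M₁ i) (hMpos : ∀ i, 1 ≤ M i)
    (hdvd : ∀ i, M₁ i ∣ M i) (hL : ∀ i, 2 ≤ L i) (F : ∀ i, Finset (CubeSite (M₁ i) (L i) (fun n => (D i n)ᶜ)))
    (kk : I → ℕ) (η R Mr : I → ℝ) (hRM : ∀ i, R i * Mr i ≤ ((M i / M₁ i : ℕ) : ℝ)) (hN : ∀ i, 2 ≤ M i / M₁ i) :
    B6Lemma21TwoScale.Lemma21TwoScale d δ₀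
      (fun i => latGeo (M₁ i) (L i) (fun n => (D i n)ᶜ) (F i) (kk i) (η i) (R i) (Mr i)) :=
  lemma21TwoScale_latGeo_family hδ M₁ L M (fun i n => (D i n)ᶜ) F kk η R Mr
    (fun i => monotone_compl_of_admissible (by have := hL i; omega) (hMpos i) (hdistD i))
    (fun i => layerSepZd_of_admissible (hdistD i))
    (fun i => tiles_of_admissible (hM₁ i) (by have := hL i; omega) (hdvd i) (hcubes i) (h0 i) (hex i)) hM₁
    (fun i => Nat.le_of_dvd (hMpos i) (hdvd i)) hL hRM hN

end Family

end Literature.MathematicalPhysics.QuantumFieldTheory.Balaban1983to89.B15LatticeCubeContours
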